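import Literature.Computability.Cryptography.CsidhGenerators
import Literature.NumberTheory.QuadraticFields.HeegnerCondition
import HarnessLib

/-!
# The order `ℤ[√-p]` inside the maximal order of `ℚ(√-p)`: ideals prime to the conductor

Topic `Computability/Cryptography`; proof file (theorems only, no definition, no named fact)
towards the discharge of `Literature.Computability.Cryptography.Csidh.jmv_smallPrimesGenerate`
(`CsidhGenerators.lean`). For a prime `p`, a quadratic number field `K` (`[K : ℚ] = 2`) and a
ring homomorphism `ι : ℤ[√-p] → 𝓞 K` (necessarily `√-p ↦ s` with `s² = -p`, and injective), we
prove the part of Cox, *Primes of the form x² + ny²*, §7.A–§7.C (orders, Prop. 7.20, Cor. 7.17)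
needed to turn characters of `cl(ℤ[√-p]) = ClassGroup (ℤ√-p)` into ray class characters of `K`
modulo `(2)`:

* `emb_injective`, `exists_emb_eq_two_mul` — `ι` is injective and **`2 · 𝓞 K ⊆ ι(ℤ[√-p])`**
  (the conductor of `ℤ[√-p]` divides `2`): with an integral basis `(1, ω)` of `𝓞 K`
  (tree: `Quadratic.exists_basis_zero_eq_one`) and `s = a + cω`, comparing coordinates in
  `s² = -p` gives `c² d_K = -4p`, so `c ∣ 2` and `2ω ∈ ℤ + ℤ s`; also
  `natAbs_discr_le_four_mul` — **`|d_K| ≤ 4p`** (indeed `|d_K| c² = 4p`);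
* `map_comap_eq_of_odd_mem`, `comap_map_eq_of_sup_eq_top`, `comap_mul_of_odd_mem` — **Cox,
  Prop. 7.20** for `𝒪 = ℤ[√-p]`, conductor `∣ 2`: `𝔞 ↦ 𝔞 ∩ 𝒪` (`Ideal.comap ι`) and `𝔟 ↦ 𝔟 𝓞_K`
  (`Ideal.map ι`) are mutually inverse on ideals prime to `2` (an `𝓞 K`-ideal containing an odd
  integer; an `𝒪`-ideal `𝔟` with `𝔟 + 𝔣' = 𝒪`, `𝔣' = ι⁻¹(2𝓞 K)`), and `𝔞 ↦ 𝔞 ∩ 𝒪` is multiplicative;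
The sequel `CsidhGeneratorsOrderIdeals.lean` adds: ideals of `ℤ[√-p]` containing an odd integer are
invertible, primes of `𝓞 K` of prime norm meet `ℤ[√-p]` in the ideals `(ℓ, t + √-p)`, and every class
of `cl(ℤ[√-p])` contains an invertible ideal containing an odd integer.

## References

* [Cox2013] D. A. Cox, *Primes of the form x² + ny²*, 2nd ed., Wiley 2013: §7.A Prop. 7.4,
  Lemma 7.5, Exercise 7.8; §7.C Lemma 7.18, Prop. 7.20, Cor. 7.17 (PDF pp. 149–160 of the held copy);
  §2.A Lemma 2.3, §2.C Lemma 2.25.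
* [JaoMillerVenkatesan2009] D. Jao, S. D. Miller, R. Venkatesan, J. Number Theory 129 (2009), Thm. 3.2
  ("the class group `Cl(𝒪_D)` is a quotient of the narrow ray class group of `K` relative to `𝔪`").
-/

noncomputable section

open scoped Classical nonZeroDivisors NumberField

namespace Literature.Computability.Cryptography.Csidh

open Literature.NumberTheory.QuadraticFields.Quadratic
open Literature.NumberTheory.QuadraticFields.Quadratic.BinQF
open NumberField Module

attribute [local instance] isDomain_zsqrtd_neg

variable (p : ℕ) [Fact p.Prime]
variable {K : Type*} [Field K] [NumberField K] (ι : ℤ√(-(p : ℤ)) →+* 𝓞 K)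

/-! ### The embedding `ι : ℤ[√-p] → 𝓞 K` -/

omit [Fact p.Prime] [NumberField K] in
/-- `ι(√-p)² = -p` (as the cast of the integer `-p`). [folklore] -/
theorem emb_sqrtd_mul_self : ι Zsqrtd.sqrtd * ι Zsqrtd.sqrtd = ((-(p : ℤ) : ℤ) : 𝓞 K) := by
  rw [← map_mul, Zsqrtd.dmuld, map_intCast]

omit [Fact p.Prime] [NumberField K] in
/-- `ι(√-p)² = -p`. [folklore] -/
theorem emb_sqrtd_mul_self' : ι Zsqrtd.sqrtd * ι Zsqrtd.sqrtd = -(p : 𝓞 K) := by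
  rw [emb_sqrtd_mul_self]
  push_cast
  ring

omit [Fact p.Prime] [NumberField K] in
/-- `ι (x + y √-p) = x + y · ι(√-p)`. [folklore] -/
theorem emb_mk (x y : ℤ) : ι ⟨x, y⟩ = (x : 𝓞 K) + (y : 𝓞 K) * ι Zsqrtd.sqrtd := by
  have h : (⟨x, y⟩ : ℤ√(-(p : ℤ))) = (x : ℤ√(-(p : ℤ))) + (y : ℤ√(-(p : ℤ))) * Zsqrtd.sqrtd := by
    ext <;> simp
  rw [h, map_add, map_mul, map_intCast, map_intCast]

omit [Fact p.Prime] [NumberField K] in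
/-- `ι z = Re z + Im z · ι(√-p)`. [folklore] -/
theorem emb_apply (z : ℤ√(-(p : ℤ))) : ι z = (z.re : 𝓞 K) + (z.im : 𝓞 K) * ι Zsqrtd.sqrtd :=
  emb_mk p ι z.re z.im

omit [Fact p.Prime] [NumberField K] in
/-- `ι` is Mathlib's `Zsqrtd.lift` at the root `ι(√-p)`. [folklore] -/
theorem emb_eq_lift : ι = Zsqrtd.lift ⟨ι Zsqrtd.sqrtd, emb_sqrtd_mul_self p ι⟩ :=
  Zsqrtd.hom_ext _ _ (by simp)

/-- **`ι` is injective** (`-p` is not a square and `𝓞 K` has characteristic zero). [folklore] -/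
theorem emb_injective : Function.Injective ι := by
  rw [emb_eq_lift p ι]
  refine Zsqrtd.lift_injective _ fun n hn => ?_
  have hp : (0 : ℤ) < p := by exact_mod_cast (Fact.out : p.Prime).pos
  nlinarith [mul_self_nonneg n]

/-! ### The quadratic structure: `2 𝓞 K ⊆ ι(ℤ[√-p])` and `|d_K| ≤ 4p` -/

omit [NumberField K] in
/-- **Coordinates of `√-p` on an integral basis `(1, ω)`.** If `[K : ℚ] = 2`, `(1, ω)` is a
`ℤ`-basis of `𝓞 K` with `ω² = m + tω`, and `s = ι(√-p) = a + cω`, then `c ≠ 0`, `2a = -ct` and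
`c² (t² + 4m) = -4p` (compare the coordinates of `s² = -p`). [folklore] -/
theorem coords_sqrtd (b : Basis (Fin 2) ℤ (𝓞 K)) (hb : b 0 = 1) :
    b.repr (ι Zsqrtd.sqrtd) 1 ≠ 0 ∧
      2 * b.repr (ι Zsqrtd.sqrtd) 0 = -(b.repr (ι Zsqrtd.sqrtd) 1 * b.repr (b 1 * b 1) 1) ∧
      b.repr (ι Zsqrtd.sqrtd) 1 ^ 2 * (b.repr (b 1 * b 1) 1 ^ 2 + 4 * b.repr (b 1 * b 1) 0) =
        -4 * p := by
  set s := ι Zsqrtd.sqrtd with hsdef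
  set ω := b 1 with hω
  set m : ℤ := b.repr (ω * ω) 0 with hm
  set t : ℤ := b.repr (ω * ω) 1 with ht
  set a : ℤ := b.repr s 0 with ha
  set c : ℤ := b.repr s 1 with hc
  have hωω : ω * ω = (m : 𝓞 K) + (t : 𝓞 K) * ω := basis_one_mul_self_eq b hb
  have hs : s = (a : 𝓞 K) + (c : 𝓞 K) * ω := by
    conv_lhs => rw [← b.sum_repr s]
    rw [Fin.sum_univ_two, hb, zsmul_eq_mul, mul_one, zsmul_eq_mul]
  have hss : s * s = -(p : 𝓞 K) := emb_sqrtd_mul_self' p ι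
  -- the relation `(a² + c² m + p) + (2ac + c² t) ω = 0`
  have hrel : ((a ^ 2 + c ^ 2 * m + p : ℤ) : 𝓞 K) + ((2 * a * c + c ^ 2 * t : ℤ) : 𝓞 K) * ω = 0 := by
    push_cast
    linear_combination hss - (s + (a : 𝓞 K) + (c : 𝓞 K) * ω) * hs - ((c : 𝓞 K) ^ 2) * hωω
  -- read off coordinates
  have hcoord : ∀ A B : ℤ, ((A : 𝓞 K) + (B : 𝓞 K) * ω = 0) → A = 0 ∧ B = 0 := by
    intro A B h
    have h' : A • b 0 + B • b 1 = 0 := by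
      rw [hb, zsmul_eq_mul, mul_one, zsmul_eq_mul]
      exact h
    have h0 := congrArg (fun x => b.repr x 0) h'
    have h1 := congrArg (fun x => b.repr x 1) h'
    simp only [map_add, map_zsmul, b.repr_self, Finsupp.coe_add, Finsupp.coe_smul, Pi.add_apply,
      Pi.smul_apply, Finsupp.single_apply, smul_eq_mul, map_zero, Finsupp.coe_zero,
      Pi.zero_apply] at h0 h1
    simp at h0 h1
    exact ⟨h0, h1⟩
  obtain ⟨h0, h1⟩ := hcoord _ _ hrel
  have hp0 : (0 : ℤ) < p := by exact_mod_cast (Fact.out : p.Prime).pos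
  have hc0 : c ≠ 0 := by
    intro hc0
    rw [hc0] at h0
    nlinarith [sq_nonneg a]
  refine ⟨hc0, ?_, ?_⟩
  · have : c * (2 * a + c * t) = 0 := by linear_combination h1
    rcases mul_eq_zero.1 this with h | h
    · exact absurd h hc0
    · linarith
  · have h2a : 2 * a = -(c * t) := by
      have : c * (2 * a + c * t) = 0 := by linear_combination h1
      rcases mul_eq_zero.1 this with h | h
      · exact absurd h hc0
      · linarith
    linear_combination 4 * h0 + (c * t - 2 * a) * h2a

/-- **`|d_K| · c² = 4p`**, hence `|d_K| ≤ 4p`, for a quadratic field containing `√-p`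
(`c` the `ω`-coordinate of `√-p`; `d_K = t² + 4m`, tree `discr_eq_sq_add_four_mul`).
[folklore] -/
theorem natAbs_discr_le_four_mul (ι : ℤ√(-(p : ℤ)) →+* 𝓞 K) (h2 : finrank ℚ K = 2) :
    (NumberField.discr K).natAbs ≤ 4 * p := by
  obtain ⟨b, hb⟩ := exists_basis_zero_eq_one h2
  obtain ⟨hc0, -, hkey⟩ := coords_sqrtd p ι b hb
  rw [← discr_eq_sq_add_four_mul b hb] at hkey
  have h := congrArg Int.natAbs hkey
  have e : (-4 * (p : ℤ)).natAbs = 4 * p := by simp [Int.natAbs_mul]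
  rw [Int.natAbs_mul, Int.natAbs_pow, e] at h
  have hdvd : (NumberField.discr K).natAbs ∣ 4 * p := Dvd.intro_left _ h
  exact Nat.le_of_dvd (by have := (Fact.out : p.Prime).pos; omega) hdvd

omit [NumberField K] in
/-- The `ω`-coordinate `c` of `√-p` divides `2` (`c² ∣ 4p` with `p` prime forces `c² ∣ 4`).
[folklore] -/
theorem repr_sqrtd_one_dvd_two (b : Basis (Fin 2) ℤ (𝓞 K)) (hb : b 0 = 1) :
    b.repr (ι Zsqrtd.sqrtd) 1 ∣ 2 := by
  obtain ⟨hc0, -, hkey⟩ := coords_sqrtd p ι b hb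
  set c := b.repr (ι Zsqrtd.sqrtd) 1 with hc
  have hp := (Fact.out : p.Prime)
  -- `c.natAbs ^ 2 ∣ 4 p`
  have hdvd : c.natAbs ^ 2 ∣ 4 * p := by
    have h := congrArg Int.natAbs hkey
    have e : (-4 * (p : ℤ)).natAbs = 4 * p := by simp [Int.natAbs_mul]
    rw [Int.natAbs_mul, Int.natAbs_pow, e] at h
    exact Dvd.intro _ h
  -- hence `c.natAbs ≤ 2`
  have hle : c.natAbs ≤ 2 := by
    by_contra hlt
    push Not at hlt
    by_cases hpc : p ∣ c.natAbs
    · -- `p² ∣ 4p` forces `p = 2`, then `c² ∣ 8`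
      have hp2 : p ^ 2 ∣ 4 * p := (pow_dvd_pow_of_dvd hpc 2).trans hdvd
      have hp4 : p ∣ 4 := by
        rw [pow_two] at hp2
        exact Nat.dvd_of_mul_dvd_mul_right hp.pos hp2
      have hp2' : p = 2 := by
        have h22 : p ∣ 2 ^ 2 := by simpa using hp4
        exact (Nat.prime_dvd_prime_iff_eq hp Nat.prime_two).1 (hp.dvd_of_dvd_pow h22)
      rw [hp2'] at hdvd
      have h8 : c.natAbs ^ 2 ≤ 8 := Nat.le_of_dvd (by norm_num) hdvd
      nlinarith
    · have hcop : Nat.Coprime (c.natAbs ^ 2) p :=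
        Nat.Coprime.pow_left 2 ((hp.coprime_iff_not_dvd).2 hpc).symm
      have h4 : c.natAbs ^ 2 ∣ 4 := hcop.dvd_of_dvd_mul_right hdvd
      have : c.natAbs ^ 2 ≤ 4 := Nat.le_of_dvd (by norm_num) h4
      nlinarith
  have hpos : 0 < c.natAbs := Int.natAbs_pos.2 hc0
  have hcases : c.natAbs = 1 ∨ c.natAbs = 2 := by omega
  rcases hcases with h | h
  · rcases Int.natAbs_eq_iff.1 h with h' | h' <;> rw [h'] <;> norm_num
  · rcases Int.natAbs_eq_iff.1 h with h' | h' <;> rw [h'] <;> norm_num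

/-- **`2 · 𝓞 K ⊆ ι(ℤ[√-p])`**: the conductor of `ℤ[√-p]` divides `2` (for `p ≡ 3 (mod 4)` the
maximal order is `ℤ[(1 + √-p)/2]`; here from `2ω ∈ ℤ + ℤ√-p` for an integral basis `(1, ω)`).
[cite: Cox2013, §7.A (conductor of an order) with Lemma 7.2] -/
theorem exists_emb_eq_two_mul (h2 : finrank ℚ K = 2) (y : 𝓞 K) :
    ∃ w : ℤ√(-(p : ℤ)), ι w = 2 * y := by
  obtain ⟨b, hb⟩ := exists_basis_zero_eq_one h2
  obtain ⟨k, hk⟩ := repr_sqrtd_one_dvd_two p ι b hb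
  set s := ι Zsqrtd.sqrtd with hsdef
  set ω := b 1 with hω
  set a : ℤ := b.repr s 0 with ha
  set c : ℤ := b.repr s 1 with hc
  have hs : s = (a : 𝓞 K) + (c : 𝓞 K) * ω := by
    conv_lhs => rw [← b.sum_repr s]
    rw [Fin.sum_univ_two, hb, zsmul_eq_mul, mul_one, zsmul_eq_mul]
  -- `2ω = k (s - a)`
  have h2ω : (2 : 𝓞 K) * ω = (k : 𝓞 K) * (s - a) := by
    have : ((2 : ℤ) : 𝓞 K) = (c : 𝓞 K) * (k : 𝓞 K) := by rw [hk]; push_cast; ring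
    rw [hs]
    push_cast at this ⊢
    linear_combination this * ω
  have hy : y = (b.repr y 0 : 𝓞 K) + (b.repr y 1 : 𝓞 K) * ω := by
    conv_lhs => rw [← b.sum_repr y]
    rw [Fin.sum_univ_two, hb, zsmul_eq_mul, mul_one, zsmul_eq_mul]
  refine ⟨⟨2 * b.repr y 0 - b.repr y 1 * k * a, b.repr y 1 * k⟩, ?_⟩
  rw [emb_mk p ι]
  push_cast
  linear_combination (-((b.repr y 1 : ℤ) : 𝓞 K)) * h2ω - 2 * hy

/-! ### Cox, Prop. 7.20: ideals prime to `2` of `𝓞 K` and of `ℤ[√-p]` correspond -/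

/-- **`(𝔞 ∩ 𝒪) 𝓞_K = 𝔞`** for an ideal `𝔞` of `𝓞 K` containing an odd integer `N` (i.e. prime to the
conductor): `x = x N - m · 2x` with `N, 2x ∈ ι(𝒪)` (Cox, Prop. 7.20, first half of the proof).
[cite: Cox2013, §7.C Prop. 7.20] -/
theorem map_comap_eq_of_odd_mem (h2 : finrank ℚ K = 2) {I : Ideal (𝓞 K)} {N : ℕ} (hN : Odd N)
    (hNI : (N : 𝓞 K) ∈ I) : (I.comap ι).map ι = I := by
  refine le_antisymm Ideal.map_comap_le fun x hx => ?_
  obtain ⟨m, hm⟩ := hN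
  obtain ⟨w, hw⟩ := exists_emb_eq_two_mul p ι h2 x
  have hwI : w ∈ I.comap ι := by
    rw [Ideal.mem_comap, hw]
    exact I.mul_mem_left _ hx
  have hNc : ((N : ℤ√(-(p : ℤ)))) ∈ I.comap ι := by
    rw [Ideal.mem_comap, map_natCast]
    exact hNI
  have hx' : x = x * (N : 𝓞 K) - (m : 𝓞 K) * (2 * x) := by
    rw [hm]
    push_cast
    ring
  rw [hx']
  refine Ideal.sub_mem _ ?_ ?_
  · have := Ideal.mem_map_of_mem ι hNc
    rw [map_natCast] at this
    exact Ideal.mul_mem_left _ _ this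
  · rw [← hw]
    exact Ideal.mul_mem_left _ _ (Ideal.mem_map_of_mem ι hwI)

/-- Elements of `𝔟 𝓞_K` times `2 𝓞_K` lie in `ι(𝔟)` (since `2 𝓞_K ⊆ ι(𝒪)` and `𝔟` is an
`𝒪`-ideal). [folklore] -/
theorem exists_mem_emb_eq_two_mul_mul (h2 : finrank ℚ K = 2) {𝔟 : Ideal (ℤ√(-(p : ℤ)))}
    {z : 𝓞 K} (hz : z ∈ 𝔟.map ι) (y : 𝓞 K) : ∃ b' ∈ 𝔟, ι b' = 2 * y * z := by
  have hz' : z ∈ Submodule.span (𝓞 K) (ι '' (𝔟 : Set (ℤ√(-(p : ℤ))))) := hz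
  revert y
  refine Submodule.span_induction
    (p := fun z _ => ∀ y : 𝓞 K, ∃ b' ∈ 𝔟, ι b' = 2 * y * z) ?_ ?_ ?_ ?_ hz'
  · rintro _ ⟨b₀, hb₀, rfl⟩ y
    obtain ⟨w, hw⟩ := exists_emb_eq_two_mul p ι h2 y
    exact ⟨w * b₀, 𝔟.mul_mem_left _ hb₀, by rw [map_mul, hw]⟩
  · intro y
    exact ⟨0, 𝔟.zero_mem, by simp⟩
  · intro z₁ z₂ _ _ h₁ h₂ y
    obtain ⟨b₁, hb₁, e₁⟩ := h₁ y
    obtain ⟨b₂, hb₂, e₂⟩ := h₂ y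
    exact ⟨b₁ + b₂, 𝔟.add_mem hb₁ hb₂, by rw [map_add, e₁, e₂]; ring⟩
  · intro r z _ hz' y
    obtain ⟨b', hb', e⟩ := hz' (y * r)
    exact ⟨b', hb', by rw [e, smul_eq_mul]; ring⟩

/-- **`(𝔟 𝓞_K) ∩ 𝒪 = 𝔟`** for an `𝒪`-ideal `𝔟` prime to `𝔣' = ι⁻¹(2𝓞_K)` (Cox, Prop. 7.20, second half:
with `1 = b₀ + f₀`, `x = x b₀ + x f₀` and `ι(x f₀) ∈ 2 · 𝔟𝓞_K ⊆ ι(𝔟)`).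
[cite: Cox2013, §7.C Prop. 7.20] -/
theorem comap_map_eq_of_sup_eq_top (h2 : finrank ℚ K = 2) {𝔟 : Ideal (ℤ√(-(p : ℤ)))}
    (h𝔟 : 𝔟 ⊔ (Ideal.span {(2 : 𝓞 K)}).comap ι = ⊤) : (𝔟.map ι).comap ι = 𝔟 := by
  refine le_antisymm (fun x hx => ?_) Ideal.le_comap_map
  rw [Ideal.mem_comap] at hx
  obtain ⟨b₀, hb₀, f₀, hf₀, hbf⟩ := Submodule.mem_sup.1
    ((h𝔟 ▸ Submodule.mem_top : (1 : ℤ√(-(p : ℤ))) ∈ 𝔟 ⊔ (Ideal.span {(2 : 𝓞 K)}).comap ι))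
  rw [Ideal.mem_comap, Ideal.mem_span_singleton] at hf₀
  obtain ⟨y, hy⟩ := hf₀
  obtain ⟨b', hb', e⟩ := exists_mem_emb_eq_two_mul_mul p ι h2 hx y
  have hxf : x * f₀ = b' := emb_injective p ι (by rw [map_mul, hy, e]; ring)
  have hx' : x = x * b₀ + x * f₀ := by rw [← mul_add, hbf, mul_one]
  rw [hx']
  exact 𝔟.add_mem (𝔟.mul_mem_left _ hb₀) (hxf ▸ hb')

omit [Fact p.Prime] [NumberField K] in
/-- `2 ∈ 𝔣' = ι⁻¹(2 𝓞_K)`. [folklore] -/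
theorem two_mem_comap_span_two : (2 : ℤ√(-(p : ℤ))) ∈ (Ideal.span {(2 : 𝓞 K)}).comap ι := by
  rw [Ideal.mem_comap, map_ofNat]
  exact Ideal.mem_span_singleton_self _

omit [Fact p.Prime] [NumberField K] in
/-- An `𝒪`-ideal containing an odd integer is prime to `𝔣'`. [folklore] -/
theorem sup_comap_span_two_eq_top_of_odd_mem {𝔟 : Ideal (ℤ√(-(p : ℤ)))} {N : ℕ} (hN : Odd N)
    (hNb : (N : ℤ√(-(p : ℤ))) ∈ 𝔟) : 𝔟 ⊔ (Ideal.span {(2 : 𝓞 K)}).comap ι = ⊤ := by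
  rw [Ideal.eq_top_iff_one]
  obtain ⟨k, hk⟩ := hN
  have h1 : (1 : ℤ√(-(p : ℤ))) = (N : ℤ√(-(p : ℤ))) - k * 2 := by
    rw [hk]
    push_cast
    ring
  rw [h1]
  exact Submodule.sub_mem _ (Submodule.mem_sup_left hNb)
    (Submodule.mem_sup_right (Ideal.mul_mem_left _ _ (two_mem_comap_span_two p ι)))

/-- **`𝔞 ↦ 𝔞 ∩ 𝒪` is multiplicative on ideals prime to `2`** (Cox, Prop. 7.20: it is the inverse of
the multiplicative `𝔟 ↦ 𝔟𝓞_K`). [cite: Cox2013, §7.C Prop. 7.20] -/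
theorem comap_mul_of_odd_mem (h2 : finrank ℚ K = 2) {I J : Ideal (𝓞 K)} {N M : ℕ} (hN : Odd N)
    (hNI : (N : 𝓞 K) ∈ I) (hM : Odd M) (hMJ : (M : 𝓞 K) ∈ J) :
    (I * J).comap ι = I.comap ι * J.comap ι := by
  have hI := map_comap_eq_of_odd_mem p ι h2 hN hNI
  have hJ := map_comap_eq_of_odd_mem p ι h2 hM hMJ
  conv_lhs => rw [← hI, ← hJ, ← Ideal.map_mul]
  apply comap_map_eq_of_sup_eq_top p ι h2
  have hNM : ((N * M : ℕ) : ℤ√(-(p : ℤ))) ∈ I.comap ι * J.comap ι := by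
    rw [Nat.cast_mul]
    refine Ideal.mul_mem_mul ?_ ?_
    · rw [Ideal.mem_comap, map_natCast]; exact hNI
    · rw [Ideal.mem_comap, map_natCast]; exact hMJ
  exact sup_comap_span_two_eq_top_of_odd_mem p ι (Nat.odd_mul.2 ⟨hN, hM⟩) hNM

end Literature.Computability.Cryptography.Csidh

end
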